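import Literature.AnabelianGeometry.SemiGraphs.ProfiniteSemiGraphHomComp
import Literature.AnabelianGeometry.SemiGraphs.ProfiniteSemiGraphIsoPullbackEquivalence
import HarnessLib

/-!
# The pull-back of coverings along a COMPOSITE of morphisms of semi-graphs of anabelioids, and along
# the identity: `(F ≫ G)^*_{θ_F ∘ θ_G} ≅ G^*_{θ_G} ⋙ F^*_{θ_F}`, `(id)^*_1 ≅ 𝟭` (route T · TRANSPORT IX)

Mochizuki, *Semi-graphs of anabelioids*, Publ. RIMS **42** (2006), §3, Proposition 3.6 (iv), manuscript
p. 39 [cite: MochizukiSemiAnbd2006, Prop 3.6(iv) p.39]: "Any morphism of semi-graphs of anabelioids `𝒢' → 𝒢`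
induces a morphism of temperoids `B^temp(𝒢') → B^temp(𝒢)` [by pulling back tempered coverings of `𝒢` to
tempered coverings of `𝒢'`]" — with Remark 2.4.2 p. 26: a morphism `φ : 𝒢 → ℋ` consists of 1-morphisms
`φ_v`, `φ_e` "together with an isomorphism `φ_b` of the composite 1-morphism of anabelioids
`𝒢_e → 𝒢_v → ℋ_w` with the composite 1-morphism of anabelioids `𝒢_e → ℋ_f → ℋ_w` whenever a branch `b`
of `e` abuts `v`.  That is to say, strictly speaking, `φ` is a “1-morphism”" (loc. cit., continued: "we may work with
such morphisms as if they are simply “morphisms in a category”, rather than 1-morphisms in a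
2-category"), and Remark 2.11.1 p. 32 (GLOSS, not a quotation: `𝒢 ↦ B(𝒢)` is functorial).  What this file
adds is the COMPATIBILITY OF THE PULL-BACK WITH COMPOSITION AND IDENTITIES, which print uses tacitly
whenever pull-back functors of composites are compared (e.g. group actions on `𝒢`, §5 Def. 5.1 (i)).

abc-iut cell, layer L3, seat abc-iut-L3-d6 (ROUTE T lineage: transport of tempered coverings along
morphisms / isomorphisms of profinite presentations).  DATA + bookkeeping over abc-iut-L3-d2's
composition `ProfiniteSemiGraph.Hom.comp` / `Hom.ConjugatorFamily.comp` (`ProfiniteSemiGraphHomComp.lean`,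
whose docstring defers exactly this item: "for the functoriality of the pull-back functors `(F ≫ G)^*_θ`
(not done here)") and abc-iut-L3-d4's pull-back functors for an ARBITRARY family of 2-cells
`Hom.covPullbackWith θ` / `btempPullbackWith θ` / `chartPullbackWith θ c' c` (`TemperedFunctorialityWith.lean`):

* `Hom.covPullbackWith_comp_glue_apply` — the gluings of `(F ≫ G)^*_{θ_F ∘ θ_G} S` and of
  `F^*_{θ_F} (G^*_{θ_G} S)` COINCIDE point by point: along a branch `b ↦ v` both are the gluing of `S`
  along `G F b` followed by the action of the pasted 2-cell `G_{F v}(θ_F(b)) · θ_G(F b)` (the vertex and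
  edge fibres agree definitionally, `B^temp(ψ) ∘ B^temp(φ) = B^temp(ψ ∘ φ)`);
* ★ `Hom.covPullbackWithCompIso : (F.comp G).covPullbackWith (θF.comp θG) ≅
  G.covPullbackWith θG ⋙ F.covPullbackWith θF` — identity on every fibre — and its `B^temp` and chart
  forms `Hom.btempPullbackWithCompIso`, `Hom.chartPullbackWithCompIso` (the latter through the unit
  isomorphism of the middle chart);
* `Hom.identityConjugators 𝒢` — the TRIVIAL family of 2-cells `θ ≡ 1` of `Hom.identity 𝒢` — and the
  unit laws `Hom.covPullbackWithIdentityIso : (Hom.identity 𝒢).covPullbackWith (identityConjugators 𝒢) ≅ 𝟭 _`,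
  `Hom.btempPullbackWithIdentityIso`, `Hom.chartPullbackWithIdentityIso` (through the counit of the chart);
* `Hom.nonempty_chartPullbackWith_mul_iso` / `…_one_iso` — the binders `hmul` / `hone` of
  `ArithOuterActionOfGraphAction.exists_outerAction_of_graphAction` in their With-form, PROVED for a graph
  action `A : Π_A → Hom 𝒢 𝒢` that is strict (`A (a b) = A b ≫ A a`, `A 1 = id`) with pasted / trivial
  2-cell data.

So `(F, θ) ↦ F^*_θ` is a PSEUDO-FUNCTOR on (1-morphisms, families of 2-cells) — the §3 / `B^cov` twin
of the §2 equality `SemiGraphOfAnabelioids.Hom.pullbackFunctor_comp` (`PullbackFunctorComp.lean`).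
HONEST SCOPE: the laws are for the COMPOSITE family `θF.comp θG` and the TRIVIAL family; for the CHOSEN
families (`Hom.covPullback = covPullbackWith chosenConjugators`, `chartPullback`) nothing is claimed —
the chosen 2-cells of `F ≫ G` need not be the pasted ones, and pull-backs along different families of
2-cells are in general not isomorphic (cell finding d4-F3 / RQ12, `TemperedReconstructionTwistIndeterminacy`);
so the pseudo-functoriality binders `hmul` / `hone` of `ArithOuterActionOfGraphAction.lean` (stated for
`chartPullback`) are discharged by these laws only for graph actions presented WITH multiplicative
2-cell data.  Definitions (natural isomorphisms) + bookkeeping only; no instance, no notation, no named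
fact; nothing of the paper is asserted; nothing here bears on [IUTchIII] Cor. 3.12.
-/

noncomputable section

open CategoryTheory Topology

namespace Literature.AnabelianGeometry.SemiGraphs

open Literature.AlgebraicGeometry.Frobenioids.QuasiTemperoid.BTempConnected (hom_ext_apply
  ρ_mul_apply ρ_one_apply)

universe u

namespace ProfiniteSemiGraph

variable {𝒢 ℋ 𝒦 : ProfiniteSemiGraph.{u}}

namespace Hom

/-! ### The composite: gluings agree 2-cell by 2-cell -/

section Comp

variable (F : Hom 𝒢 ℋ) (G : Hom ℋ 𝒦) (θF : F.ConjugatorFamily) (θG : G.ConjugatorFamily)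

/-- The vertex fibres of `(F ≫ G)^*_{θ_F ∘ θ_G} S` and of `F^*_{θ_F} (G^*_{θ_G} S)` are the same object of
`B^temp(Π_v)` (restriction of scalars along a composite is the composite restriction, definitionally).
[cite: MochizukiSemiAnbd2006, Prop 3.6(iv) p.39] -/
theorem covPullbackWith_comp_obj_SV (S : CovObj 𝒦) (v : 𝒢.graph.Vertex) :
    (((F.comp G).covPullbackWith (θF.comp θG)).obj S).SV v =
      ((F.covPullbackWith θF).obj ((G.covPullbackWith θG).obj S)).SV v :=
  rfl

/-- The edge fibres of `(F ≫ G)^*_{θ_F ∘ θ_G} S` and of `F^*_{θ_F} (G^*_{θ_G} S)` are the same object of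
`B^temp(Π_e)`. [cite: MochizukiSemiAnbd2006, Prop 3.6(iv) p.39] -/
theorem covPullbackWith_comp_obj_SE (S : CovObj 𝒦) (e : 𝒢.graph.Edge) :
    (((F.comp G).covPullbackWith (θF.comp θG)).obj S).SE e =
      ((F.covPullbackWith θF).obj ((G.covPullbackWith θG).obj S)).SE e :=
  rfl

/-- **The gluings agree.** Along a branch `b ↦ v` of `𝒢`, the gluing of `(F ≫ G)^*_{θ_F ∘ θ_G} S` is the
gluing of `S` along `G F b` (at the transported point) followed by the action of the pasted 2-cell
`G_{F v}(θ_F(b)) · θ_G(F b)`; the gluing of `F^*_{θ_F} (G^*_{θ_G} S)` is the gluing of `G^*_{θ_G} S` along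
`F b` followed by `θ_F(b)` acting through `G_{F v}` — and the former gluing is that of `S` along `G F b`
followed by `θ_G(F b)`.  [cite: MochizukiSemiAnbd2006, Rmk 2.4.2 p.26] -/
theorem covPullbackWith_comp_glue_apply (S : CovObj 𝒦) (b : 𝒢.graph.Branch) (v : 𝒢.graph.Vertex)
    (h : 𝒢.graph.abuts b = some v)
    (x : ((((F.comp G).covPullbackWith (θF.comp θG)).obj S).SE (𝒢.graph.edgeOf b)).obj.V) :
    ((((F.comp G).covPullbackWith (θF.comp θG)).obj S).glue b v h).hom.hom.hom x =
      (((F.covPullbackWith θF).obj ((G.covPullbackWith θG).obj S)).glue b v h).hom.hom.hom x := by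
  rw [covPullbackWith_glue_apply_castPtE, covPullbackWith_glue_apply_castPtE,
    covPullbackWith_glue_apply_castPtE, CovObj.castPtE_covPullbackWith, CovObj.castPtE_castPtE,
    ConjugatorFamily.comp_θ]
  exact (ρ_mul_apply (S.SV ((F.comp G).base.vertexMap v)) _ _ _).trans rfl

/-- The comparison isomorphism `(F ≫ G)^*_{θ_F ∘ θ_G} S ≅ F^*_{θ_F} (G^*_{θ_G} S)` of one object:
identity on every vertex and edge fibre (the gluings agree, `covPullbackWith_comp_glue_apply`).
[cite: MochizukiSemiAnbd2006, Prop 3.6(iv) p.39] -/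
def covPullbackWithCompIsoApp (S : CovObj 𝒦) :
    ((F.comp G).covPullbackWith (θF.comp θG)).obj S ≅
      (F.covPullbackWith θF).obj ((G.covPullbackWith θG).obj S) :=
  CovObj.isoOfComponents
    (fun v => BTemp.isoOfEquiv (Equiv.refl _) fun _ _ => rfl)
    (fun e => BTemp.isoOfEquiv (Equiv.refl _) fun _ _ => rfl)
    (fun b v h => hom_ext_apply fun x => by
      change (((F.covPullbackWith θF).obj ((G.covPullbackWith θG).obj S)).glue b v h).hom.hom.hom x =
        ((((F.comp G).covPullbackWith (θF.comp θG)).obj S).glue b v h).hom.hom.hom x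
      rw [covPullbackWith_comp_glue_apply])

/-- The comparison isomorphism is the identity on vertex fibres. [cite: MochizukiSemiAnbd2006, Prop 3.6(iv) p.39] -/
@[simp] theorem covPullbackWithCompIsoApp_hom_fV_apply (S : CovObj 𝒦) (v : 𝒢.graph.Vertex)
    (x : ((((F.comp G).covPullbackWith (θF.comp θG)).obj S).SV v).obj.V) :
    ((F.covPullbackWithCompIsoApp G θF θG S).hom.fV v).hom.hom x = x :=
  rfl

/-- The comparison isomorphism is the identity on edge fibres. [cite: MochizukiSemiAnbd2006, Prop 3.6(iv) p.39] -/
@[simp] theorem covPullbackWithCompIsoApp_hom_fE_apply (S : CovObj 𝒦) (e : 𝒢.graph.Edge)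
    (x : ((((F.comp G).covPullbackWith (θF.comp θG)).obj S).SE e).obj.V) :
    ((F.covPullbackWithCompIsoApp G θF θG S).hom.fE e).hom.hom x = x :=
  rfl

/-- The inverse comparison isomorphism is the identity on vertex fibres. [cite: MochizukiSemiAnbd2006, Prop 3.6(iv) p.39] -/
@[simp] theorem covPullbackWithCompIsoApp_inv_fV_apply (S : CovObj 𝒦) (v : 𝒢.graph.Vertex)
    (x : (((F.covPullbackWith θF).obj ((G.covPullbackWith θG).obj S)).SV v).obj.V) :
    ((F.covPullbackWithCompIsoApp G θF θG S).inv.fV v).hom.hom x = x :=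
  rfl

/-- The inverse comparison isomorphism is the identity on edge fibres. [cite: MochizukiSemiAnbd2006, Prop 3.6(iv) p.39] -/
@[simp] theorem covPullbackWithCompIsoApp_inv_fE_apply (S : CovObj 𝒦) (e : 𝒢.graph.Edge)
    (x : (((F.covPullbackWith θF).obj ((G.covPullbackWith θG).obj S)).SE e).obj.V) :
    ((F.covPullbackWithCompIsoApp G θF θG S).inv.fE e).hom.hom x = x :=
  rfl

/-- ★ **Pull-back along a composite is the composite pull-back**, as functors `B^cov(𝒦) ⥤ B^cov(𝒢)`:
`(F ≫ G)^*_{θ_F ∘ θ_G} ≅ G^*_{θ_G} ⋙ F^*_{θ_F}` for the PASTED family of 2-cells `θ_F ∘ θ_G`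
(`ConjugatorFamily.comp`) — identity on every fibre, hence natural.
[cite: MochizukiSemiAnbd2006, Prop 3.6(iv) p.39] -/
def covPullbackWithCompIso :
    (F.comp G).covPullbackWith (θF.comp θG) ≅ G.covPullbackWith θG ⋙ F.covPullbackWith θF :=
  NatIso.ofComponents (fun S => F.covPullbackWithCompIsoApp G θF θG S) fun f => by
    refine CovHom.ext (funext fun v => ?_) (funext fun e => ?_) <;> exact hom_ext_apply fun _ => rfl

/-- `(F ≫ G)^*` of a tempered object, read through the comparison: the composite pull-back of a tempered
object is tempered (either side; here from abc-iut-L3-d4's `isTempered_covPullbackWith` twice).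
[cite: MochizukiSemiAnbd2006, Prop 3.6(iv) p.39] -/
theorem isTempered_covPullbackWith_covPullbackWith {S : CovObj 𝒦} (hS : S.IsTempered) :
    ((F.covPullbackWith θF).obj ((G.covPullbackWith θG).obj S)).IsTempered :=
  F.isTempered_covPullbackWith θF (G.isTempered_covPullbackWith θG hS)

/-- ★ **The `B^temp` form**: `(F ≫ G)^*_{θ_F ∘ θ_G} ≅ G^*_{θ_G} ⋙ F^*_{θ_F}` as functors
`B^temp(𝒦) ⥤ B^temp(𝒢)` (Proposition 3.6 (iv)'s functors; through the full embeddings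
`B^temp ↪ B^cov`, under which both sides lie over the `B^cov` functors definitionally).
[cite: MochizukiSemiAnbd2006, Prop 3.6(iv) p.39] -/
def btempPullbackWithCompIso :
    (F.comp G).btempPullbackWith (θF.comp θG) ≅ G.btempPullbackWith θG ⋙ F.btempPullbackWith θF :=
  ((ObjectProperty.fullyFaithfulι _).whiskeringRight _).preimageIso
    (Functor.isoWhiskerLeft (ObjectProperty.ι _) (F.covPullbackWithCompIso G θF θG))

/-- The `B^temp` comparison lies over the `B^cov` comparison: its component at a tempered `S` IS the
`B^cov` component (definitional bookkeeping for consumers computing with points).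
[cite: MochizukiSemiAnbd2006, Prop 3.6(iv) p.39] -/
theorem btempPullbackWithCompIso_hom_app (S : BTempCat 𝒦) :
    ((F.btempPullbackWithCompIso G θF θG).hom.app S).hom =
      (F.covPullbackWithCompIsoApp G θF θG S.obj).hom :=
  rfl

/-- ★ **The chart form**: for charts `c_𝒢`, `c_ℋ`, `c_𝒦` of the tempered fundamental groups,
`(F ≫ G)^*_{θ_F ∘ θ_G} ≅ G^*_{θ_G} ⋙ F^*_{θ_F}` as functors `B^temp(π₁^temp 𝒦) ⥤ B^temp(π₁^temp 𝒢)` read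
through the charts (`chartPullbackWith θ c' c = c⁻¹ ⋙ F^*_θ ⋙ c'`); the middle chart `c_ℋ` cancels by the
unit isomorphism of its equivalence `B^temp(ℋ) ≌ B^temp(π₁^temp ℋ)`.
[cite: MochizukiSemiAnbd2006, Prop 3.6(iv) p.39] -/
def chartPullbackWithCompIso (c𝒢 : TemperedPiChart 𝒢) (cℋ : TemperedPiChart ℋ)
    (c𝒦 : TemperedPiChart 𝒦) :
    (F.comp G).chartPullbackWith (θF.comp θG) c𝒢 c𝒦 ≅
      G.chartPullbackWith θG cℋ c𝒦 ⋙ F.chartPullbackWith θF c𝒢 cℋ :=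
  -- `c𝒦⁻¹ ⋙ (F ≫ G)^* ⋙ c𝒢 ≅ c𝒦⁻¹ ⋙ (G^* ⋙ F^*) ⋙ c𝒢`
  Functor.isoWhiskerLeft c𝒦.equiv.inverse
      (Functor.isoWhiskerRight (F.btempPullbackWithCompIso G θF θG) c𝒢.equiv.functor) ≪≫
    -- insert `cℋ ⋙ cℋ⁻¹ ≅ 𝟭` between `G^*` and `F^*`
    Functor.isoWhiskerLeft c𝒦.equiv.inverse
      (Functor.isoWhiskerRight
        (Functor.isoWhiskerLeft (G.btempPullbackWith θG)
          ((Functor.leftUnitor _).symm ≪≫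
            Functor.isoWhiskerRight cℋ.equiv.unitIso (F.btempPullbackWith θF) ≪≫
            Functor.associator _ _ _) ≪≫
          (Functor.associator _ _ _).symm)
        c𝒢.equiv.functor) ≪≫
    -- reassociate to `(c𝒦⁻¹ ⋙ G^* ⋙ cℋ) ⋙ (cℋ⁻¹ ⋙ F^* ⋙ c𝒢)`
    Functor.isoWhiskerLeft c𝒦.equiv.inverse (Functor.associator _ _ _) ≪≫
    (Functor.associator _ _ _).symm ≪≫
    Functor.isoWhiskerRight (Functor.associator _ _ _).symm _ ≪≫
    Functor.isoWhiskerLeft _ (Functor.associator _ _ _)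

end Comp

/-! ### The identity: the trivial family of 2-cells, and the unit laws -/

section Identity

variable (𝒢)

/-- **The trivial family of 2-cells of the identity** 1-morphism: `θ_b = 1` for every branch (the branch
squares of `Hom.identity` commute on the nose). [cite: MochizukiSemiAnbd2006, Rmk 2.4.2 p.26] -/
def identityConjugators : (Hom.identity 𝒢).ConjugatorFamily where
  θ _ _ _ := 1
  spec b v h x := by
    rw [one_mul, inv_one, mul_one]
    rfl

/-- The trivial family, evaluated. [cite: MochizukiSemiAnbd2006, Rmk 2.4.2 p.26] -/
@[simp] theorem identityConjugators_θ (b : 𝒢.graph.Branch) (v : 𝒢.graph.Vertex)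
    (h : 𝒢.graph.abuts b = some v) : (identityConjugators 𝒢).θ b v h = 1 := rfl

/-- **The gluings of `(id)^*_1 S` are those of `S`.** [cite: MochizukiSemiAnbd2006, Prop 3.6(iv) p.39] -/
theorem covPullbackWith_identity_glue_apply (S : CovObj 𝒢) (b : 𝒢.graph.Branch) (v : 𝒢.graph.Vertex)
    (h : 𝒢.graph.abuts b = some v)
    (x : ((((Hom.identity 𝒢).covPullbackWith (identityConjugators 𝒢)).obj S).SE (𝒢.graph.edgeOf b)).obj.V) :
    ((((Hom.identity 𝒢).covPullbackWith (identityConjugators 𝒢)).obj S).glue b v h).hom.hom.hom x =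
      (S.glue b v h).hom.hom.hom x := by
  rw [covPullbackWith_glue_apply_castPtE, identityConjugators_θ, ρ_one_apply]
  rfl

/-- The comparison isomorphism `(id)^*_1 S ≅ S` of one object: identity on every fibre.
[cite: MochizukiSemiAnbd2006, Prop 3.6(iv) p.39] -/
def covPullbackWithIdentityIsoApp (S : CovObj 𝒢) :
    ((Hom.identity 𝒢).covPullbackWith (identityConjugators 𝒢)).obj S ≅ S :=
  CovObj.isoOfComponents
    (fun v => BTemp.isoOfEquiv (Equiv.refl _) fun _ _ => rfl)
    (fun e => BTemp.isoOfEquiv (Equiv.refl _) fun _ _ => rfl)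
    (fun b v h => hom_ext_apply fun x => by
      change (S.glue b v h).hom.hom.hom x =
        ((((Hom.identity 𝒢).covPullbackWith (identityConjugators 𝒢)).obj S).glue b v h).hom.hom.hom x
      rw [covPullbackWith_identity_glue_apply])

/-- The comparison isomorphism is the identity on vertex fibres. [cite: MochizukiSemiAnbd2006, Prop 3.6(iv) p.39] -/
@[simp] theorem covPullbackWithIdentityIsoApp_hom_fV_apply (S : CovObj 𝒢) (v : 𝒢.graph.Vertex)
    (x : ((((Hom.identity 𝒢).covPullbackWith (identityConjugators 𝒢)).obj S).SV v).obj.V) :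
    (((covPullbackWithIdentityIsoApp 𝒢 S).hom.fV v).hom.hom x : (S.SV v).obj.V) = x :=
  rfl

/-- The comparison isomorphism is the identity on edge fibres. [cite: MochizukiSemiAnbd2006, Prop 3.6(iv) p.39] -/
@[simp] theorem covPullbackWithIdentityIsoApp_hom_fE_apply (S : CovObj 𝒢) (e : 𝒢.graph.Edge)
    (x : ((((Hom.identity 𝒢).covPullbackWith (identityConjugators 𝒢)).obj S).SE e).obj.V) :
    (((covPullbackWithIdentityIsoApp 𝒢 S).hom.fE e).hom.hom x : (S.SE e).obj.V) = x :=
  rfl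

/-- ★ **Pull-back along the identity (trivial 2-cells) is the identity functor** of `B^cov(𝒢)`.
[cite: MochizukiSemiAnbd2006, Prop 3.6(iv) p.39] -/
def covPullbackWithIdentityIso :
    (Hom.identity 𝒢).covPullbackWith (identityConjugators 𝒢) ≅ 𝟭 (CovObj 𝒢) :=
  NatIso.ofComponents (fun S => covPullbackWithIdentityIsoApp 𝒢 S) fun f => by
    refine CovHom.ext (funext fun v => ?_) (funext fun e => ?_) <;> exact hom_ext_apply fun _ => rfl

/-- ★ **The `B^temp` form of the unit law**: `(id)^*_1 ≅ 𝟭` on `B^temp(𝒢)`.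
[cite: MochizukiSemiAnbd2006, Prop 3.6(iv) p.39] -/
def btempPullbackWithIdentityIso :
    (Hom.identity 𝒢).btempPullbackWith (identityConjugators 𝒢) ≅ 𝟭 (BTempCat 𝒢) :=
  ((ObjectProperty.fullyFaithfulι _).whiskeringRight _).preimageIso
    (Functor.isoWhiskerLeft (ObjectProperty.ι _) (covPullbackWithIdentityIso 𝒢) ≪≫
      Functor.rightUnitor _ ≪≫ (Functor.leftUnitor _).symm)

/-- ★ **The chart form of the unit law**: read through ONE chart `c` on both sides,
`(id)^*_1 ≅ 𝟭` on `B^temp(π₁^temp 𝒢)` (the chart cancels by the counit of its equivalence).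
[cite: MochizukiSemiAnbd2006, Prop 3.6(iv) p.39] -/
def chartPullbackWithIdentityIso (c : TemperedPiChart 𝒢) :
    (Hom.identity 𝒢).chartPullbackWith (identityConjugators 𝒢) c c ≅ 𝟭 (BTemp c.G) :=
  Functor.isoWhiskerLeft c.equiv.inverse
      (Functor.isoWhiskerRight (btempPullbackWithIdentityIso 𝒢) c.equiv.functor ≪≫
        Functor.leftUnitor _) ≪≫
    c.equiv.counitIso

end Identity

/-! ### The pseudo-functoriality binders of a graph action presented WITH multiplicative 2-cell data -/

section GraphAction

variable {PA : Type*} [Group PA] (A : PA → Hom 𝒢 𝒢) (θ : ∀ a, (A a).ConjugatorFamily)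
  (c : TemperedPiChart 𝒢)

/-- **The binder `hmul`, With-form, for STRICT actions with pasted 2-cells.**  For a family
`A : Π_A → Hom 𝒢 𝒢` of 1-morphisms with 2-cell data `θ a` ([SemiAnbd] Def. 5.1 (i): "an action of `π̂₁(A)`
on `𝔾`" by automorphisms of the semi-graph of anabelioids) such that `A (a b) = A b ≫ A a` as 1-morphisms and
`θ (a b)` is the pasted family `θ b ∘ θ a`: `(A (a b))^*_{θ(ab)} ≅ (A a)^*_{θ a} ⋙ (A b)^*_{θ b}` through any
chart — the shape of the binder `hmul` of `ArithOuterActionOfGraphAction.exists_outerAction_of_graphAction`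
(there for the CHOSEN 2-cells, where it stays a binder). [cite: MochizukiSemiAnbd2006, Def 5.1 (i), p. 62] -/
theorem nonempty_chartPullbackWith_mul_iso (a b : PA) (hab : A (a * b) = (A b).comp (A a))
    (hθ : θ (a * b) = hab ▸ (θ b).comp (θ a)) :
    Nonempty ((A (a * b)).chartPullbackWith (θ (a * b)) c c ≅
      (A a).chartPullbackWith (θ a) c c ⋙ (A b).chartPullbackWith (θ b) c c) := by
  have key : ∀ (H : Hom 𝒢 𝒢) (hH : H = (A b).comp (A a)) (θH : H.ConjugatorFamily),
      θH = hH ▸ (θ b).comp (θ a) →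
      Nonempty (H.chartPullbackWith θH c c ≅
        (A a).chartPullbackWith (θ a) c c ⋙ (A b).chartPullbackWith (θ b) c c) := by
    rintro H rfl θH rfl
    exact ⟨(A b).chartPullbackWithCompIso (A a) (θ b) (θ a) c c c⟩
  exact key _ hab _ hθ

/-- **The binder `hone`, With-form, for STRICT actions with pasted 2-cells**: if `A 1` is the identity
1-morphism with the trivial 2-cells, `(A 1)^*_{θ 1} ≅ 𝟭` through any chart — the shape of the binder `hone`
of `ArithOuterActionOfGraphAction.exists_outerAction_of_graphAction`.
[cite: MochizukiSemiAnbd2006, Def 5.1 (i), p. 62] -/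
theorem nonempty_chartPullbackWith_one_iso (h1 : A 1 = Hom.identity 𝒢)
    (hθ1 : θ 1 = h1 ▸ identityConjugators 𝒢) :
    Nonempty ((A 1).chartPullbackWith (θ 1) c c ≅ 𝟭 (BTemp c.G)) := by
  have key : ∀ (H : Hom 𝒢 𝒢) (hH : H = Hom.identity 𝒢) (θH : H.ConjugatorFamily),
      θH = hH ▸ identityConjugators 𝒢 → Nonempty (H.chartPullbackWith θH c c ≅ 𝟭 (BTemp c.G)) := by
    rintro H rfl θH rfl
    exact ⟨chartPullbackWithIdentityIso 𝒢 c⟩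
  exact key _ h1 _ hθ1

end GraphAction

end Hom

end ProfiniteSemiGraph

end Literature.AnabelianGeometry.SemiGraphs

end
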